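import Literature.NumberTheory.Automorphic.LocalGLCongruenceBoxIwahori
import Literature.NumberTheory.Automorphic.CMPrincipalSeriesJacquetEvalOne
import Literature.NumberTheory.Automorphic.SmoothIndOpenCellHaarFunctional
import Literature.NumberTheory.Automorphic.ReductionTheoryGLnConjugation
import HarnessLib

/-!
# The open-cell standard section of `i_G(χ)` on `U(Φ_N)(L⁺_v)`: a function vanishing at `1` with indicator cell function and
# NON-ZERO class in the Jacquet module — `ℓ ≠ 0` for node N1

Topic `NumberTheory/Automorphic`; namespace `Literature.NumberTheory.Automorphic.UnitaryGroup`.  THEOREMS ONLY (no definition, no named fact,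
no `sorry`, no instance, no notation).  Registry pub/hodgecm-mathlib F0∕P3, line `F0_P3_KeysCaseTwoPaydown`, node N1 (★
`U3PrincipalSeriesJacquetFiltration`, [Casselman1995, Lemma 7.1.1 (a)]): with ★ `SmoothIndOpenCellHaarFunctional` (open-cell classes are
non-zero) this file supplies the LAST lower-bound input — an ACTUAL element of `i_G(χ)` supported in the open cell `B w₀ N` whose cell
function is an indicator: hence the closed-cell kernel `ℓ = ker ev₁` of the Jacquet module (Summit-side ★ `closedCell_cmPrincipalSeries`)
is NON-ZERO.

## The construction ([BernsteinZelevinsky1976, §2.21–2.24; 1977, §5]; [Casselman1995, §6.3, Prop. 1.4.4])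
Let `K''` be an open subgroup of `G = U(σ, Φ_N)(E_v)` (`E_v = Π_{w∣v} E_w`) such that the inducing representation `σ′` of `B` fixes `w` on
`B ∩ K''`.  Shrink `K''` to a **congruence box** `K′ = G ∩ Π_w K_{γ_w}`, `0 < γ_w < 1` (★ `exists_forall_mem_congruenceGL_subset`), take the
★ section `f₁` of `i_B^G σ′` supported on `B·K′` with `f₁(b κ) = σ′(b) w` (★ `Representation.exists_mem_fixedPoints_toFun_eq_of_isOpen`), and
translate it: `Φ := w₀⁻¹ · f₁`, `Φ(x) = f₁(x w₀⁻¹)`.  Then (i) `Φ(1) = f₁(w₀⁻¹) = 0` because `w₀ ∉ B N̄ ⊇ B K′` (Iwahori factorisation of the box,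
★ `borel_mul_lower_ne_inv_of_coe_eq_antidiagonal`), and (ii) `Φ(w₀ n) = f₁(w₀ n w₀⁻¹)` with `w₀ n w₀⁻¹ ∈ N̄` (★
`conj_mem_lower_of_mem_upperUnitriangular`): it is `w` if `w₀ n w₀⁻¹ ∈ K′` and `0` otherwise, since `N̄ ∩ B K′ ⊆ K′` (★
`forall_mem_congruenceGL_of_lower_eq_borel_mul`) — an INDICATOR cell function `1_K · w`, `K = {n : w₀ n w₀⁻¹ ∈ K′}` compact open non-empty in `N`.
§2 specialises to `U(Φ_N)(L⁺_v)`, `χ` a CONTINUOUS character of the torus (the open `K''` from ★ `CMPrincipalSeriesJacquetEvalOne` ∕ ★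
`SmoothIndClosedCellNonzero`), and concludes with ★ `mk_restrict_cmPrincipalSeries_ne_zero_of_cellFun_eq_indicator`:
**`∃ Φ ∈ i_G(χ), Φ(1) = 0 ∧ [Φ] ≠ 0` in `r_B i_G(χ)`** (every `N ≥ 2`, every finite `v`); §3 the `N = 3` pair `χ = (χ₁, χ₂)` of N1.

HC_CM is proved only modulo the printed citations until rung 0 closes; this file alone discharges no named fact.

## References
* [Casselman1995] W. Casselman, *Introduction to the theory of admissible representations of `p`-adic reductive groups* (1995),
  Prop. 1.4.4, §6.3 (proof of Thm. 6.3.5), Lemma 7.1.1 (a).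
* [BernsteinZelevinsky1976] I. N. Bernstein, A. V. Zelevinsky, Russian Math. Surveys 31:3 (1976), §2.21–2.24, §3.13.
* [BernsteinZelevinsky1977] I. N. Bernstein, A. V. Zelevinsky, Ann. Sci. ÉNS (4) 10 (1977), §5, Geometrical Lemma 2.12.
* [Rogawski1990] J. Rogawski, Ann. of Math. Stud. 123 (1990), §1.10 p. 9, §12.2 pp. 173–174.
-/

set_option autoImplicit false

noncomputable section

open scoped MatrixGroups
open Topology Matrix OrderDual

namespace Literature.NumberTheory.Automorphic

namespace UnitaryGroup

/-! ## §1 The open-cell section of `i_B^G σ′` on `G = U(σ, Φ_N)(E_v)` -/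

section Local

open _root_.NumberField _root_.IsDedekindDomain

variable {F : Type} [Field F] [NumberField F] (E : Type) [Field E] [NumberField E] [Algebra F E]
  (c : E ≃ₐ[F] E) (N : ℕ) (v : HeightOneSpectrum (𝓞 F)) {J' : Matrix (Fin N) (Fin N) (LocalRing E v)}
  (hJ : J' = (StdForm.antidiagonal N).over (LocalRing E v))

include hJ in
/-- **`Φ_N ∈ U(σ, Φ_N)(E_v)`: there is `w₀ ∈ G` with matrix `Φ_N`** (the long Weyl element; `σ(Φ_N) = Φ_N = ᵗΦ_N`, `Φ_N² = 1`).
[cite: Rogawski1990, §1.10 p. 9] -/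
theorem exists_coe_eq_antidiagonal :
    ∃ w₀ : ↥(unitaryGroupOfForm (conjLocal E c v) J'),
      ((w₀ : ↥(unitaryGroupOfForm (conjLocal E c v) J')) : GL (Fin N) (LocalRing E v)).val =
        (StdForm.antidiagonal N).over (LocalRing E v) := by
  let g : GL (Fin N) (LocalRing E v) :=
    ⟨(StdForm.antidiagonal N).over (LocalRing E v), (StdForm.antidiagonal N).over (LocalRing E v),
      (StdForm.antidiagonal N).over_mul_over _, (StdForm.antidiagonal N).over_mul_over _⟩
  refine ⟨⟨g, ?_⟩, rfl⟩
  rw [mem_unitaryGroupOfForm_iff]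
  change (((StdForm.antidiagonal N).over (LocalRing E v)).map (conjLocal E c v))ᵀ * J' * (StdForm.antidiagonal N).over (LocalRing E v) = J'
  rw [StdForm.over_map, StdForm.transpose_over, hJ, StdForm.over_mul_over, Matrix.one_mul]

/-- **THE OPEN-CELL STANDARD SECTION.**  `G = U(σ, Φ_N)(E_v)`, `N ≥ 2`, `B ≤ G` the Borel (★ `borelTriple`), `σ′` any representation of `B`,
`w₀ ∈ G` with matrix `Φ_N`, `K''` an open subgroup of `G` and `w` a vector fixed by `σ′(B ∩ K'')`.  Then there is `Φ ∈ i_B^G σ′` with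
`Φ(1) = 0` whose cell function at `w₀` on `N` is the indicator `1_K · w` of a NON-EMPTY COMPACT OPEN `K ⊆ N`.
[cite: BernsteinZelevinsky1977, §5 (5.1)–(5.2)] [cite: Casselman1995, Prop. 1.4.4 and §6.3] -/
theorem exists_openCellSection (hN : 2 ≤ N) {W : Type*} [AddCommGroup W] [Module ℂ W]
    (σ' : Representation ℂ ↥(borelTriple (conjLocal E c v) J' hJ).P W)
    (w₀ : ↥(unitaryGroupOfForm (conjLocal E c v) J'))
    (hw₀ : ((w₀ : ↥(unitaryGroupOfForm (conjLocal E c v) J')) : GL (Fin N) (LocalRing E v)).val =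
      (StdForm.antidiagonal N).over (LocalRing E v))
    {K'' : Subgroup ↥(unitaryGroupOfForm (conjLocal E c v) J')} (hK'' : IsOpen (K'' : Set ↥(unitaryGroupOfForm (conjLocal E c v) J')))
    {w : W} (hw : ∀ b : ↥(borelTriple (conjLocal E c v) J' hJ).P, (b : ↥(unitaryGroupOfForm (conjLocal E c v) J')) ∈ K'' → σ' b w = w) :
    ∃ Φ : Representation.SmoothInd (borelTriple (conjLocal E c v) J' hJ).P σ',
      Φ.toFun 1 = 0 ∧ ∃ K : Set ↥(borelTriple (conjLocal E c v) J' hJ).N, IsOpen K ∧ IsCompact K ∧ K.Nonempty ∧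
        ∀ n : ↥(borelTriple (conjLocal E c v) J' hJ).N,
          Φ.toFun ((w₀ : ↥(unitaryGroupOfForm (conjLocal E c v) J')) * n) = K.indicator (fun _ => w) n := by
  classical
  haveI : Nontrivial (LocalRing E v) := by
    obtain ⟨w⟩ : Nonempty (PlacesOver E v) := inferInstance
    exact ⟨⟨0, 1, fun h => zero_ne_one (congrFun h w)⟩⟩
  -- abbreviations of types
  let G := ↥(unitaryGroupOfForm (conjLocal E c v) J')
  -- (1) a congruence box `K′ ⊆ K''`
  obtain ⟨V, hVo, hVK⟩ := isOpen_induced_iff.1 hK''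
  have hV1 : V ∈ 𝓝 (1 : GL (Fin N) (LocalRing E v)) := by
    refine hVo.mem_nhds ?_
    have : (1 : G) ∈ ((↑) : G → GL (Fin N) (LocalRing E v)) ⁻¹' V := by rw [hVK]; exact K''.one_mem
    exact this
  obtain ⟨γ, hγ, hγV⟩ := exists_forall_mem_congruenceGL_subset E N v hV1
  let K' : Subgroup G :=
    (Subgroup.pi Set.univ fun w : PlacesOver E v => congruenceGL N (γ w)).comap
      ((localGLPiEquiv E N v).toMonoidHom.comp (unitaryGroupOfForm (conjLocal E c v) J').subtype)
  have hmemK' : ∀ u : G, u ∈ K' ↔ ∀ w, localGLPiEquiv E N v (u : GL (Fin N) (LocalRing E v)) w ∈ congruenceGL N (γ w) := by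
    intro u
    simp only [K', Subgroup.mem_comap, MonoidHom.coe_comp, Function.comp_apply, Subgroup.mem_pi, Set.mem_univ,
      true_implies]
    rfl
  have hK'sub : ∀ u : G, u ∈ K' → u ∈ K'' := fun u hu => by
    have h : (u : GL (Fin N) (LocalRing E v)) ∈ V := hγV _ ((hmemK' u).1 hu)
    have h' : u ∈ ((↑) : G → GL (Fin N) (LocalRing E v)) ⁻¹' V := h
    rw [hVK] at h'
    exact h'
  have hK'eq : (K' : Set G) = ((↑) : G → GL (Fin N) (LocalRing E v)) ⁻¹'
      {g | ∀ w, localGLPiEquiv E N v g w ∈ congruenceGL N (γ w)} := by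
    ext u; exact hmemK' u
  have hK'o : IsOpen (K' : Set G) := by
    rw [hK'eq]
    exact (isOpen_setOf_forall_mem_congruenceGL E N v γ fun w => (hγ w).1).preimage continuous_subtype_val
  have hK'c : IsCompact (K' : Set G) := by
    rw [hK'eq]
    exact (isClosed_unitaryGroupOfForm (continuous_conjLocal E c v) J').isClosedEmbedding_subtypeVal.isCompact_preimage
      (isCompact_setOf_forall_mem_congruenceGL E N v γ)
  -- (2) the section `f₁` supported on `B·K′`
  have hw' : w ∈ σ'.fixedPoints (K'.subgroupOf (borelTriple (conjLocal E c v) J' hJ).P) :=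
    (σ'.mem_fixedPoints _ w).2 fun b hb => hw b (hK'sub _ (Subgroup.mem_subgroupOf.1 hb))
  obtain ⟨f₁, -, -, hf₁on, hf₁off⟩ := Representation.exists_mem_fixedPoints_toFun_eq_of_isOpen σ' hK'o hw'
  -- (3) translate: `Φ(x) = f₁(x w₀⁻¹)`
  refine ⟨Representation.smoothIndRep _ σ' (w₀⁻¹ : G) f₁, ?_, {n | (w₀ : G) * (n : G) * (w₀ : G)⁻¹ ∈ K'}, ?_, ?_, ⟨1, by simp [K'.one_mem]⟩, ?_⟩
  · -- `Φ(1) = f₁(w₀⁻¹) = 0`: `w₀ ∉ B·K′ ⊆ B·N̄`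
    rw [Representation.toFun_smoothIndRep_apply, one_mul]
    refine hf₁off _ fun h κ hκ heq => ?_
    obtain ⟨p, hpP, -, u, huU, -, hpu⟩ :=
      exists_borel_mul_lower_of_forall_mem_congruenceGL E N v γ (fun w => (hγ w).2) _ ((hmemK' κ).1 hκ)
    have hb : ((h : G) : GL (Fin N) (LocalRing E v)) * p ∈ standardParabolicGL (LocalRing E v) (_root_.id : Fin N → Fin N) :=
      Subgroup.mul_mem _ h.2 hpP
    refine borel_mul_lower_ne_inv_of_coe_eq_antidiagonal hw₀ hN hb huU ?_
    rw [mul_assoc, ← hpu, ← Subgroup.coe_mul, ← heq, Subgroup.coe_inv]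
  · -- `K` open
    exact hK'o.preimage ((continuous_const.mul continuous_subtype_val).mul continuous_const)
  · -- `K` compact: preimage of the compact `w₀⁻¹ K′ w₀`… via the closed embedding `N → G` composed with conjugation
    have hemb : IsClosedEmbedding fun n : ↥(borelTriple (conjLocal E c v) J' hJ).N => (w₀ : G) * (n : G) * (w₀ : G)⁻¹ := by
      have h1 : IsClosedEmbedding ((↑) : ↥(borelTriple (conjLocal E c v) J' hJ).N → G) :=
        IsClosed.isClosedEmbedding_subtypeVal
          ((isClosed_upperUnitriangular (n := N) (R := LocalRing E v)).preimage continuous_subtype_val)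
      exact ((Homeomorph.mulRight (w₀ : G)⁻¹).isClosedEmbedding.comp
        ((Homeomorph.mulLeft (w₀ : G)).isClosedEmbedding.comp h1))
    exact hemb.isCompact_preimage hK'c
  · -- the cell function is the indicator
    intro n
    rw [Representation.toFun_smoothIndRep_apply]
    have hlow : (((w₀ : G) * (n : G) * (w₀ : G)⁻¹ : G) : GL (Fin N) (LocalRing E v)) ∈
        unipotentRadicalGL (LocalRing E v) (⇑toDual ∘ (_root_.id : Fin N → Fin N)) := by
      rw [Subgroup.coe_mul, Subgroup.coe_mul, Subgroup.coe_inv]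
      exact conj_mem_lower_of_mem_upperUnitriangular hw₀ n.2
    by_cases hmem : (w₀ : G) * (n : G) * (w₀ : G)⁻¹ ∈ K'
    · rw [Set.indicator_of_mem (s := {m : ↥(borelTriple (conjLocal E c v) J' hJ).N | (w₀ : G) * (m : G) * (w₀ : G)⁻¹ ∈ K'}) hmem]
      have h := hf₁on 1 _ hmem
      rwa [Subgroup.coe_one, one_mul, map_one, Module.End.one_apply] at h
    · rw [Set.indicator_of_notMem (s := {m : ↥(borelTriple (conjLocal E c v) J' hJ).N | (w₀ : G) * (m : G) * (w₀ : G)⁻¹ ∈ K'}) hmem]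
      refine hf₁off _ fun h κ hκ heq => hmem ?_
      rw [hmemK']
      exact forall_mem_congruenceGL_of_lower_eq_borel_mul E N v γ (fun w => (hγ w).2) hlow h.2 ((hmemK' κ).1 hκ)
        (congrArg Subtype.val heq)

end Local

/-! ## §2 The CM principal series: `∃ Φ ∈ i_G(χ)`, `Φ(1) = 0`, `[Φ] ≠ 0` — the closed-cell kernel `ℓ` is non-zero -/

section CM

open _root_.NumberField _root_.IsDedekindDomain

variable (L : Type) [Field L] [NumberField L] [IsCMField L] (N : ℕ) (v : HeightOneSpectrum (𝓞 ↥(maximalRealSubfield L)))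

set_option synthInstance.maxHeartbeats 400000 in
set_option maxHeartbeats 1600000 in
/-- **the open-cell section of the CM principal series** (`N ≥ 2`, `χ` continuous): `w₀ = Φ_N ∈ G`, `Φ ∈ i_G(χ)` with `Φ(1) = 0` and cell function
`n ↦ Φ(w₀ n) = 1_K(n)` for a non-empty compact open `K ⊆ N(L⁺_v)` — §1 at the open subgroup on which `χ∘proj·δ_B^{1/2}` is trivial (★
`ParabolicTriple.exists_isOpen_forall_twist_comp_proj_eq_one`; `G` non-archimedean ★ `nonarchimedeanGroup_cmLocal`, `B` closed, `K_v` compact open, `χ∘proj`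
continuous ★ `continuous_apply_proj_borelTriple`). [cite: BernsteinZelevinsky1977, §5 (5.1)–(5.2)] [cite: Casselman1995, Prop. 1.4.4 and §6.3] -/
theorem exists_cmPrincipalSeries_openCellSection (hN : 2 ≤ N)
    (χ : ↥(torusU (conjLocal L (IsCMField.complexConj L) v) (cmLocalForm L N v)) →* ℂˣ) (hχ : Continuous fun t => ((χ t : ℂˣ) : ℂ)) :
    haveI := locallyCompactSpace_cmBorelU L N v
    ∃ w₀ : ↥(unitaryGroupOfForm (conjLocal L (IsCMField.complexConj L) v) (cmLocalForm L N v)),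
      ∃ Φ : Representation.SmoothInd (cmBorelTriple L N v).P
        (Representation.twist
          (((Representation.trivial ℂ ↥(torusU (conjLocal L (IsCMField.complexConj L) v) (cmLocalForm L N v)) ℂ).twist χ).comp
            (cmBorelTriple L N v).proj) (rootDeltaChar (cmBorelTriple L N v).P)),
        Φ.toFun 1 = 0 ∧ ∃ K : Set ↥(cmBorelTriple L N v).N, IsOpen K ∧ IsCompact K ∧ K.Nonempty ∧
          ∀ n : ↥(cmBorelTriple L N v).N,
            Φ.toFun ((w₀ : ↥(unitaryGroupOfForm (conjLocal L (IsCMField.complexConj L) v) (cmLocalForm L N v))) * n) =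
              K.indicator (fun _ => (1 : ℂ)) n := by
  haveI := locallyCompactSpace_cmBorelU L N v
  haveI := nonarchimedeanGroup_cmLocal L N v
  have hK := isCompact_isOpen_cmLocalIntegralLevel L N (Matrix.of fun i j : Fin N => if i.val + j.val + 1 = N then (1 : L) else 0) v
  -- the open subgroup on which the inducing character is trivial
  obtain ⟨K'', hK''o, hK''⟩ := (cmBorelTriple L N v).exists_isOpen_forall_twist_comp_proj_eq_one
    (isClosed_borelU (conjLocal L (IsCMField.complexConj L) v) (cmLocalForm L N v)) hK.2 hK.1 χ
    (continuous_apply_proj_borelTriple (conjLocal L (IsCMField.complexConj L) v) (cmLocalForm L N v) (cmLocalForm_eq_over L N v) χ hχ)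
  -- the long Weyl element and the section
  obtain ⟨w₀, hw₀⟩ := exists_coe_eq_antidiagonal L (IsCMField.complexConj L) N v (cmLocalForm_eq_over L N v)
  obtain ⟨Φ, hΦ1, K, hKo, hKc, hKn, hΦ⟩ := exists_openCellSection L (IsCMField.complexConj L) N v (cmLocalForm_eq_over L N v) hN _ w₀ hw₀
    hK''o (w := (1 : ℂ)) fun b hb => hK'' b hb 1
  exact ⟨w₀, Φ, hΦ1, K, hKo, hKc, hKn, hΦ⟩

set_option synthInstance.maxHeartbeats 400000 in
set_option maxHeartbeats 1600000 in
/-- **`ℓ ≠ 0` FOR THE PRINCIPAL SERIES OF `U(Φ_N)(L⁺_v)`** (`N ≥ 2`, every finite `v`, every CONTINUOUS character `χ` of the torus): there is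
`Φ ∈ i_G(χ)` with `Φ(1) = 0` — so `[Φ]` lies in the closed-cell kernel `ℓ = ker ev₁` of `r_B i_G(χ)` — and `[Φ] ≠ 0` in the Jacquet-module
carrier `((cmBorelTriple L N v).restrict (i_G χ)).Coinvariants` (the section above + the open-cell Haar functional ★
`mk_restrict_cmPrincipalSeries_ne_zero_of_cellFun_eq_indicator`). [cite: Casselman1995, Lemma 7.1.1 (a) and §6.3]
[cite: BernsteinZelevinsky1977, Geometrical Lemma 2.12 and §5 (5.2)] [cite: Rogawski1990, §12.2 pp. 173–174] -/
theorem exists_cmPrincipalSeries_toFun_one_eq_zero_and_mk_ne_zero (hN : 2 ≤ N)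
    (χ : ↥(torusU (conjLocal L (IsCMField.complexConj L) v) (cmLocalForm L N v)) →* ℂˣ) (hχ : Continuous fun t => ((χ t : ℂˣ) : ℂ)) :
    haveI := locallyCompactSpace_cmBorelU L N v
    ∃ Φ : Representation.SmoothInd (cmBorelTriple L N v).P
        (Representation.twist
          (((Representation.trivial ℂ ↥(torusU (conjLocal L (IsCMField.complexConj L) v) (cmLocalForm L N v)) ℂ).twist χ).comp
            (cmBorelTriple L N v).proj) (rootDeltaChar (cmBorelTriple L N v).P)),
      Φ.toFun 1 = 0 ∧ Representation.Coinvariants.mk ((cmBorelTriple L N v).restrict (cmPrincipalSeries L N v χ)) Φ ≠ 0 := by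
  haveI := locallyCompactSpace_cmBorelU L N v
  have h := exists_cmPrincipalSeries_openCellSection L N v hN χ hχ
  exact h.elim fun w₀ hw => hw.elim fun Φ hΦ => hΦ.2.elim fun K hK =>
    ⟨Φ, hΦ.1, mk_restrict_cmPrincipalSeries_ne_zero_of_cellFun_eq_indicator L N v χ w₀ hK.1 hK.2.1 hK.2.2.1 one_ne_zero Φ hK.2.2.2⟩

end CM

/-! ## §3 `N = 3`: the pair `χ = (χ₁, χ₂)` of ★ `U3PrincipalSeriesJacquetFiltration` -/

section Three

open _root_.NumberField _root_.IsDedekindDomain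

variable (L : Type) [Field L] [NumberField L] [IsCMField L] (v : HeightOneSpectrum (𝓞 ↥(maximalRealSubfield L)))
  (χ₁ : (LocalRing L v)ˣ →* ℂˣ) (χ₂ : ↥(normOneUnits (conjLocal L (IsCMField.complexConj L) v)) →* ℂˣ)

set_option synthInstance.maxHeartbeats 400000 in
set_option maxHeartbeats 1600000 in
/-- **N1, open-cell lower bound**: for continuous `χ₁`, `χ₂` there is `Φ ∈ i_G(χ₁, χ₂)` with `Φ(1) = 0` and `[Φ] ≠ 0` in
`r = ((cmBorelTriple L 3 v).restrict (cmPrincipalSeries L 3 v (cmTorusCharPair L v χ₁ χ₂))).Coinvariants` — with the Summit-side ★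
`closedCell_cmPrincipalSeries` (`x ∈ ℓ ↔ ∃ f, f 1 = 0 ∧ [f] = x`) this is `ℓ ≠ ⊥`. [cite: Casselman1995, Lemma 7.1.1 (a)] [cite: Rogawski1990, §12.2 pp. 173–174] -/
theorem exists_cmPrincipalSeries_cmTorusCharPair_toFun_one_eq_zero_and_mk_ne_zero (h₁ : Continuous fun x => ((χ₁ x : ℂˣ) : ℂ))
    (h₂ : Continuous fun x => ((χ₂ x : ℂˣ) : ℂ)) :
    haveI := locallyCompactSpace_cmBorelU L 3 v
    ∃ Φ : Representation.SmoothInd (cmBorelTriple L 3 v).P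
        (Representation.twist
          (((Representation.trivial ℂ ↥(torusU (conjLocal L (IsCMField.complexConj L) v) (cmLocalForm L 3 v)) ℂ).twist
            (cmTorusCharPair L v χ₁ χ₂)).comp (cmBorelTriple L 3 v).proj) (rootDeltaChar (cmBorelTriple L 3 v).P)),
      Φ.toFun 1 = 0 ∧
        Representation.Coinvariants.mk ((cmBorelTriple L 3 v).restrict (cmPrincipalSeries L 3 v (cmTorusCharPair L v χ₁ χ₂))) Φ ≠ 0 :=
  exists_cmPrincipalSeries_toFun_one_eq_zero_and_mk_ne_zero L 3 v (by norm_num) _ (continuous_cmTorusCharPair_apply L v χ₁ χ₂ h₁ h₂)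

end Three


/-! ## §3 (ED. 2) The integral of the open-cell section against a Haar measure of `N` is non-zero
(the `Φ`-input of ★ `ParabolicTriple.normalizedJacquet_eq_smul_of_openCellLine`, for a GIVEN Weyl representative `w₀`) -/

section CMIntegral

open _root_.NumberField _root_.IsDedekindDomain _root_.MeasureTheory

variable (L : Type) [Field L] [NumberField L] [IsCMField L] (N : ℕ) (v : HeightOneSpectrum (𝓞 ↥(maximalRealSubfield L)))

set_option synthInstance.maxHeartbeats 400000 in
set_option maxHeartbeats 1600000 in
/-- **The open-cell section has non-zero `N`-integral** (`N ≥ 2`, `χ` continuous, `w₀ ∈ G` ANY element whose matrix is `Φ_N`,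
`μ` any Haar measure on `N(L⁺_v)`): there is `Φ ∈ i_G(χ)` with `Φ(1) = 0`, compactly supported cell function `n ↦ Φ(w₀ n)`
(`= 1_K`, `K` compact open non-empty, §1–§2) and `∫_N Φ(w₀ n) dμ(n) = μ(K) ≠ 0`.
[cite: BernsteinZelevinsky1977, §5 (5.1)–(5.2)] [cite: Casselman1995, Lemma 7.1.1 (a) and §6.3] -/
theorem exists_cmPrincipalSeries_toFun_one_eq_zero_and_integral_cellFun_ne_zero (hN : 2 ≤ N)
    (χ : ↥(torusU (conjLocal L (IsCMField.complexConj L) v) (cmLocalForm L N v)) →* ℂˣ) (hχ : Continuous fun t => ((χ t : ℂˣ) : ℂ))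
    (w₀ : ↥(unitaryGroupOfForm (conjLocal L (IsCMField.complexConj L) v) (cmLocalForm L N v)))
    (hw₀ : Units.val (w₀ : GL (Fin N) (LocalRing L v)) = cmLocalForm L N v)
    [MeasurableSpace ↥(cmBorelTriple L N v).N] [BorelSpace ↥(cmBorelTriple L N v).N]
    (μ : Measure ↥(cmBorelTriple L N v).N) [μ.IsOpenPosMeasure] [IsFiniteMeasureOnCompacts μ] :
    haveI := locallyCompactSpace_cmBorelU L N v
    ∃ Φ : Representation.SmoothInd (cmBorelTriple L N v).P
        (Representation.twist
          (((Representation.trivial ℂ ↥(torusU (conjLocal L (IsCMField.complexConj L) v) (cmLocalForm L N v)) ℂ).twist χ).comp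
            (cmBorelTriple L N v).proj) (rootDeltaChar (cmBorelTriple L N v).P)),
      Φ.toFun 1 = 0 ∧
      (HasCompactSupport fun n : ↥(cmBorelTriple L N v).N =>
        Φ.toFun ((w₀ : ↥(unitaryGroupOfForm (conjLocal L (IsCMField.complexConj L) v) (cmLocalForm L N v))) * n)) ∧
      ∫ n : ↥(cmBorelTriple L N v).N,
          Φ.toFun ((w₀ : ↥(unitaryGroupOfForm (conjLocal L (IsCMField.complexConj L) v) (cmLocalForm L N v))) * n) ∂μ ≠ 0 := by
  haveI := locallyCompactSpace_cmBorelU L N v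
  haveI := nonarchimedeanGroup_cmLocal L N v
  have hK := isCompact_isOpen_cmLocalIntegralLevel L N (Matrix.of fun i j : Fin N => if i.val + j.val + 1 = N then (1 : L) else 0) v
  -- the open subgroup on which the inducing character is trivial
  obtain ⟨K'', hK''o, hK''⟩ := (cmBorelTriple L N v).exists_isOpen_forall_twist_comp_proj_eq_one
    (isClosed_borelU (conjLocal L (IsCMField.complexConj L) v) (cmLocalForm L N v)) hK.2 hK.1 χ
    (continuous_apply_proj_borelTriple (conjLocal L (IsCMField.complexConj L) v) (cmLocalForm L N v) (cmLocalForm_eq_over L N v) χ hχ)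
  have hw₀' : ((w₀ : ↥(unitaryGroupOfForm (conjLocal L (IsCMField.complexConj L) v) (cmLocalForm L N v))) :
      GL (Fin N) (LocalRing L v)).val = (StdForm.antidiagonal N).over (LocalRing L v) := by
    rw [hw₀, cmLocalForm_eq_over]
  obtain ⟨Φ, hΦ1, K, hKo, hKc, hKn, hΦ⟩ := exists_openCellSection L (IsCMField.complexConj L) N v (cmLocalForm_eq_over L N v) hN _
    w₀ hw₀' hK''o (w := (1 : ℂ)) fun b hb => hK'' b hb 1
  have hcell : (fun n : ↥(cmBorelTriple L N v).N =>
      Φ.toFun ((w₀ : ↥(unitaryGroupOfForm (conjLocal L (IsCMField.complexConj L) v) (cmLocalForm L N v))) * n)) =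
        K.indicator fun _ => (1 : ℂ) :=
    funext hΦ
  refine ⟨Φ, hΦ1, ?_, ?_⟩
  · rw [hcell]
    exact HasCompactSupport.intro hKc fun n hn => Set.indicator_of_notMem hn _
  · rw [hcell, integral_indicator_const (1 : ℂ) hKo.measurableSet]
    refine smul_ne_zero ?_ one_ne_zero
    rw [measureReal_def]
    exact (ENNReal.toReal_pos (hKo.measure_pos μ hKn).ne' hKc.measure_lt_top.ne).ne'

end CMIntegral

section ThreeIntegral

open _root_.NumberField _root_.IsDedekindDomain _root_.MeasureTheory

variable (L : Type) [Field L] [NumberField L] [IsCMField L] (v : HeightOneSpectrum (𝓞 ↥(maximalRealSubfield L)))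
  (χ₁ : (LocalRing L v)ˣ →* ℂˣ) (χ₂ : ↥(normOneUnits (conjLocal L (IsCMField.complexConj L) v)) →* ℂˣ)

set_option synthInstance.maxHeartbeats 400000 in
set_option maxHeartbeats 1600000 in
/-- **The same for `χ = (χ₁, χ₂)` on `U(Φ₃)`** (`χ₁`, `χ₂` continuous; `w₀` with matrix `Φ₃` — e.g. the one of ★
`U3LocalBruhatDecomposition_holds`; `μ` any Haar measure on `N(L⁺_v)`): `∃ Φ ∈ i_G(χ₁, χ₂)`, `Φ(1) = 0`, compactly supported cell
function, `∫_N Φ(w₀ n) dμ ≠ 0`. [cite: Casselman1995, Lemma 7.1.1 (a)] [cite: Rogawski1990, §12.2 pp. 173–174] -/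
theorem exists_cmPrincipalSeries_cmTorusCharPair_toFun_one_eq_zero_and_integral_cellFun_ne_zero
    (h₁ : Continuous fun x => ((χ₁ x : ℂˣ) : ℂ)) (h₂ : Continuous fun x => ((χ₂ x : ℂˣ) : ℂ))
    (w₀ : ↥(unitaryGroupOfForm (conjLocal L (IsCMField.complexConj L) v) (cmLocalForm L 3 v)))
    (hw₀ : Units.val (w₀ : GL (Fin 3) (LocalRing L v)) = cmLocalForm L 3 v)
    [MeasurableSpace ↥(cmBorelTriple L 3 v).N] [BorelSpace ↥(cmBorelTriple L 3 v).N]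
    (μ : Measure ↥(cmBorelTriple L 3 v).N) [μ.IsOpenPosMeasure] [IsFiniteMeasureOnCompacts μ] :
    haveI := locallyCompactSpace_cmBorelU L 3 v
    ∃ Φ : Representation.SmoothInd (cmBorelTriple L 3 v).P
        (Representation.twist
          (((Representation.trivial ℂ ↥(torusU (conjLocal L (IsCMField.complexConj L) v) (cmLocalForm L 3 v)) ℂ).twist
            (cmTorusCharPair L v χ₁ χ₂)).comp (cmBorelTriple L 3 v).proj) (rootDeltaChar (cmBorelTriple L 3 v).P)),
      Φ.toFun 1 = 0 ∧
      (HasCompactSupport fun n : ↥(cmBorelTriple L 3 v).N =>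
        Φ.toFun ((w₀ : ↥(unitaryGroupOfForm (conjLocal L (IsCMField.complexConj L) v) (cmLocalForm L 3 v))) * n)) ∧
      ∫ n : ↥(cmBorelTriple L 3 v).N,
          Φ.toFun ((w₀ : ↥(unitaryGroupOfForm (conjLocal L (IsCMField.complexConj L) v) (cmLocalForm L 3 v))) * n) ∂μ ≠ 0 :=
  exists_cmPrincipalSeries_toFun_one_eq_zero_and_integral_cellFun_ne_zero L 3 v (by norm_num) _
    (continuous_cmTorusCharPair_apply L v χ₁ χ₂ h₁ h₂) w₀ hw₀ μ

end ThreeIntegral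

end UnitaryGroup

end Literature.NumberTheory.Automorphic

end
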